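import Literature.NumberTheory.GaloisRepresentations.AlgebraicHeckeCharacterGrossencharakterProofs
import Literature.NumberTheory.GaloisRepresentations.CMTypeHeckeCharacter
import Literature.NumberTheory.EllipticCurves.HeegnerPointsImaginaryQuadraticProofs
import Literature.NumberTheory.QuadraticFields.UnitsModCubes
import Literature.NumberTheory.QuadraticFields.IntegralBasisConjugation
import Literature.NumberTheory.Automorphic.GaloisActionPlaces
import Literature.NumberTheory.LFunctions.RayClassCharacter
import HarnessLib

/-!
# Route C `PrintCf2RubinValueTwo`, crux `GoodTwistDictionaryAtTwo` (stmt-BirchSwinnertonDyer-23295), PART 2 / F2A: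
# a type-`(1,0)` Hecke character of an imaginary quadratic field is PINNED UP TO ROOTS OF UNITY at every unramified
# principal prime, and its values at `w` and `c • w` are not proportional by a root of unity

Cell `bsd-print-cf2`, width seat `bsd-line-cf2c-w2` g9 (prover-bsd-line-cf2c-w2-g9-0); Theses-free helper
`--supports stmt-BirchSwinnertonDyer-23295`. THEOREMS ONLY (no `def`, no named fact, no `sorry`); nothing about BSD is asserted;
no summit statement is proved by this seat; BSD is not proved by any of this.

WHY (PART 2 PLAN, HOME STATUS): the comparison `ψ_{W′}(ϖ_w) = (ε/p)·ψ_W(ϖ_w)` of the Deuring characters of two members (file F2B)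
uses Deuring's Frobenius clauses (sums and products at split primes), which only determine the UNORDERED pair
`{ψ′(ϖ_w), ψ′(ϖ_{c•w})}`; the order is fixed by the INFINITY TYPE, through the Grössencharakter identity of the tree
(`HeckeCharacter.HasInfinityType.idealPow_span_eq`, Neukirch VII (6.13)–(6.14)):

* §1 `exists_pow_valueAtUniformizer_eq_pow_prod_embedding` — `K` imaginary quadratic, `ψ` of type `(1,0)`, `w` unramified with
  `𝔭_w = (α)`: **`ψ(ϖ_w)^N = e(α)^N` for some `N ≥ 1`** (`e` the embedding of the unique infinite place; `N` = the order of
  `α` in `(𝓞_K/𝔪)ˣ` for a modulus `𝔪` of `ψ` supported on the ramified places, so that `α^N ≡ 1 (mod 𝔪)`).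
* §2 `eq_one_or_eq_neg_one_of_pow_eq_one` — for `d_K < −4` the only roots of unity in `K` are `±1` (units of `𝓞_K`,
  `Quadratic.units_eq_one_or_neg_one`).
* §3 ★ `valueAtUniformizer_smul_pow_ne_pow` — `K` imaginary quadratic with `d_K < −4` and `h_K = 1`, `ψ` of type `(1,0)`
  unramified at `w` and at `c • w ≠ w` (`c ∈ Aut(K)`): **`ψ(ϖ_{c•w})^M ≠ ψ(ϖ_w)^M` for every `M ≥ 1`** — else
  `e(cα)^{L} = e(α)^{L}`, `(cα/α)^L = 1`, `cα = ±α`, `c • w = w`.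

References: [NeukirchANT1999] Ch. VII §6 Def. (6.1), Prop. (6.13), Cor. (6.14); [Weil1956] §1; [BhargavaVarma2016] Lemma 13 (units of
imaginary quadratic orders); [SilvermanATAEC1994] Ch. II §9–§10 (context: Deuring's Grössencharacter).
-/

set_option autoImplicit false
-- D-0017 layout: summit = sub-problem, so `Summit.BirchSwinnertonDyer.BirchSwinnertonDyer.…` repeats a path component.
set_option linter.dupNamespace false

noncomputable section

open scoped Classical Pointwise ComplexConjugate
open NumberField IsDedekindDomain Field
open Literature.NumberTheory.GaloisRepresentations Literature.NumberTheory.EllipticCurves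
open Literature.NumberTheory.LFunctions

namespace Summit.BirchSwinnertonDyer.BirchSwinnertonDyer.Theorems.PrintCf2.GoodTwistDictTypePin

variable {K : Type} [Field K] [NumberField K]

/-! ## §1 Type `(1,0)` pins the Frobenius values up to roots of unity -/

/-- An imaginary quadratic field has no real embedding. [folklore] -/
theorem isEmpty_ringHom_real (hK : IsImaginaryQuadratic K) : IsEmpty (K →+* ℝ) := by
  haveI := hK.2
  refine ⟨fun φ ↦ NumberField.IsTotallyComplex.complexEmbedding_not_isReal ((algebraMap ℝ ℂ).comp φ) ?_⟩
  rw [NumberField.ComplexEmbedding.isReal_iff]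
  ext x
  simp [NumberField.ComplexEmbedding.conjugate_coe_eq]

/-- The unique infinite place of an imaginary quadratic field: every infinite place equals it, and a product over the infinite
places is the value at it. [folklore] -/
theorem exists_forall_infinitePlace_eq (hK : IsImaginaryQuadratic K) :
    ∃ w₀ : InfinitePlace K, ∀ w : InfinitePlace K, w = w₀ := by
  obtain ⟨w₀, hw₀⟩ := Fintype.card_eq_one_iff.mp hK.card_infinitePlace_eq_one
  exact ⟨w₀, hw₀⟩

/-- In an imaginary quadratic field a product over the infinite places has one factor. [folklore] -/
theorem prod_infinitePlace_eq (hK : IsImaginaryQuadratic K) {w₀ : InfinitePlace K} (hw₀ : ∀ w : InfinitePlace K, w = w₀)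
    (f : InfinitePlace K → ℂ) : ∏ w : InfinitePlace K, f w = f w₀ := by
  have huniv : (Finset.univ : Finset (InfinitePlace K)) = {w₀} := by
    ext w
    simp [hw₀ w]
  have _ := hK
  rw [huniv, Finset.prod_singleton]

omit [NumberField K] in
/-- If `(α) = 𝔭_w` then `α ≠ 0`. [folklore] -/
theorem ne_zero_of_span_eq {w : HeightOneSpectrum (𝓞 K)} {α : 𝓞 K} (hα : Ideal.span {α} = w.asIdeal) : α ≠ 0 := by
  rintro rfl
  exact w.ne_bot (by rw [← hα, Ideal.span_singleton_eq_bot])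

/-- A generator of `𝔭_w` lies in no other nonzero prime. [folklore] -/
theorem not_mem_of_span_eq_of_ne {w v : HeightOneSpectrum (𝓞 K)} {α : 𝓞 K} (hα : Ideal.span {α} = w.asIdeal) (hvw : v ≠ w) :
    α ∉ v.asIdeal := by
  intro hmem
  have hle : w.asIdeal ≤ v.asIdeal := by
    rw [← hα, Ideal.span_singleton_le_iff_mem]
    exact hmem
  exact hvw (HeightOneSpectrum.ext (w.isMaximal.eq_of_le v.isPrime.ne_top hle).symm)

/-- **Type `(1,0)` pins the Frobenius value at a principal unramified prime up to a root of unity.** `K` imaginary quadratic,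
`ψ` a Hecke character of infinity type `(1,0)`, `w` a finite place at which `ψ` is unramified, `𝔭_w = (α)`. Then for some `N ≥ 1`:
`ψ(ϖ_w)^N = ∏_{wi} e_{wi}(α)^N` (one factor: the embedding of the unique infinite place). Proof: take a modulus `𝔪` of `ψ` on the
ramified places (`exists_isModulus_of_ramified`); `α` is prime to `𝔪`, so `α^N ≡ 1 (mod 𝔪)` for `N = #(𝓞_K/𝔪)ˣ`; the Grössencharakter
identity `HasInfinityType.idealPow_span_eq` at `b = α^N`, `c = 1` reads `ψ(𝔭_w)^N = e(α^N)` (no real places, type `(1,0)`).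
[cite: NeukirchANT1999, Ch. VII §6 Prop. (6.13) and Cor. (6.14)] [cite: Weil1956, §1] -/
theorem exists_pow_valueAtUniformizer_eq_pow_prod_embedding (hK : IsImaginaryQuadratic K) {ψ : HeckeCharacter K}
    (hψ : ψ.HasInfinityType (fun _ ↦ 1) (fun _ ↦ 0)) {w : HeightOneSpectrum (𝓞 K)} (hw : ψ.IsUnramifiedAt w) {α : 𝓞 K}
    (hα : Ideal.span {α} = w.asIdeal) :
    ∃ N : ℕ, 0 < N ∧ ψ.valueAtUniformizer w ^ N = (∏ wi : InfinitePlace K, wi.embedding (α : K)) ^ N := by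
  classical
  -- a modulus supported on the ramified places
  obtain ⟨e, hmod⟩ := ψ.exists_isModulus_of_ramified
  set T : Finset (HeightOneSpectrum (𝓞 K)) := (HeckeCharacter.finite_ramifiedPlaces_holds ψ).toFinset with hT
  have hwT : w ∉ T := fun h ↦ ((HeckeCharacter.finite_ramifiedPlaces_holds ψ).mem_toFinset.mp h) hw
  have hα0 : α ≠ 0 := ne_zero_of_span_eq hα
  -- `α` is prime to the modulus ideal `𝔪`
  have h𝔪 := HeckeCharacter.modulusIdeal_ne_bot T e
  have hcop : IsCoprime (Ideal.span {α}) (HeckeCharacter.modulusIdeal T e) := by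
    rw [isCoprime_iff_forall_not_le h𝔪]
    intro v hv hle
    rw [HeckeCharacter.modulusIdeal_le_iff] at hv
    have hmem : α ∈ v.asIdeal := by rw [Ideal.span_singleton_le_iff_mem] at hle; exact hle
    have hvw : v ≠ w := fun h ↦ hwT (h ▸ hv)
    exact not_mem_of_span_eq_of_ne hα hvw hmem
  -- so `α` is a unit modulo `𝔪`, of finite order `N`
  obtain ⟨i, hi, j, hj, hij⟩ := Ideal.isCoprime_iff_exists.mp hcop
  obtain ⟨r, rfl⟩ := Ideal.mem_span_singleton'.mp hi
  haveI : Finite (𝓞 K ⧸ HeckeCharacter.modulusIdeal T e) := Ideal.finiteQuotientOfFreeOfNeBot _ h𝔪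
  have hunit : IsUnit (Ideal.Quotient.mk (HeckeCharacter.modulusIdeal T e) α) := by
    refine IsUnit.of_mul_eq_one (Ideal.Quotient.mk (HeckeCharacter.modulusIdeal T e) r) ?_
    rw [← map_mul, mul_comm, eq_comm, ← (Ideal.Quotient.mk (HeckeCharacter.modulusIdeal T e)).map_one, Ideal.Quotient.eq,
      ← hij, add_sub_cancel_left]
    exact hj
  obtain ⟨u, hu⟩ := hunit
  set N : ℕ := Nat.card (𝓞 K ⧸ HeckeCharacter.modulusIdeal T e)ˣ with hN
  have hNpos : 0 < N := Nat.card_pos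
  have huN : u ^ N = 1 := pow_card_eq_one'
  have hαN : α ^ N - 1 ∈ HeckeCharacter.modulusIdeal T e := by
    rw [← Ideal.Quotient.eq, map_pow, map_one, ← hu, ← Units.val_pow_eq_pow_val, huN, Units.val_one]
  -- the Grössencharakter identity at `b = α^N`, `c = 1`
  have hb : α ^ N ≠ 0 := pow_ne_zero N hα0
  have hcop1 : IsCoprime (Ideal.span {(1 : 𝓞 K)}) (HeckeCharacter.modulusIdeal T e) :=
    Ideal.isCoprime_iff_exists.mpr ⟨1, Ideal.mem_span_singleton_self 1, 0, Submodule.zero_mem _, add_zero 1⟩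
  have hpos : ∀ φ : K →+* ℝ, 0 < φ (α ^ N : 𝓞 K) * φ (1 : 𝓞 K) := fun φ ↦ (isEmpty_ringHom_real hK).elim φ
  have hbc : α ^ N - (1 : 𝓞 K) ∈ HeckeCharacter.modulusIdeal T e := hαN
  have key := hψ.idealPow_span_eq hmod hb one_ne_zero hcop1 hbc hpos
  -- left side: `ψ(𝔭_w)^N`; right side: `e(α)^N`
  rw [Ideal.span_singleton_one, idealPow_top, one_mul, show Ideal.span {α ^ N} = w.asIdeal ^ N by
      rw [← Ideal.span_singleton_pow, hα], idealPow_pow _ w.ne_bot, idealPow_asIdeal] at key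
  refine ⟨N, hNpos, key.trans ?_⟩
  rw [← Finset.prod_pow]
  refine Finset.prod_congr rfl fun wi _ ↦ ?_
  simp [map_pow]

/-! ## §2 The roots of unity of `K` (`d_K < −4`) are `±1` -/

/-- **For `d_K < −4` the only roots of unity in `K` are `±1`**: a root of unity is an algebraic integer and a unit of `𝓞_K`, and the
units are `±1` (`Quadratic.units_eq_one_or_neg_one`). [cite: BhargavaVarma2016, Lemma 13] -/
theorem eq_one_or_eq_neg_one_of_pow_eq_one (h2 : Module.finrank ℚ K = 2) (hD : NumberField.discr K < -4) {x : K} {N : ℕ}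
    (hN : 0 < N) (hx : x ^ N = 1) : x = 1 ∨ x = -1 := by
  have hint : IsIntegral ℤ x := IsIntegral.of_pow hN (by rw [hx]; exact isIntegral_one)
  set y : 𝓞 K := ⟨x, hint⟩ with hy
  have hyx : (y : K) = x := rfl
  have hyN : y ^ N = 1 := by
    apply Subtype.ext
    change (y : K) ^ N = 1
    rw [hyx, hx]
  have hyu : IsUnit y := IsUnit.of_pow_eq_one hyN hN.ne'
  obtain ⟨u, hu⟩ := hyu
  obtain ⟨T⟩ := Literature.NumberTheory.QuadraticFields.Quadratic.nonempty_tauData (K := K) h2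
  rcases Literature.NumberTheory.QuadraticFields.Quadratic.TauData.units_eq_one_or_neg_one T h2 hD u with h | h
  · left
    rw [← hyx, ← hu, h]; rfl
  · right
    rw [← hyx, ← hu, h]; rfl

/-! ## §3 The values at `w` and `c • w` are not proportional by a root of unity -/

/-- The conjugate place of a principal prime: `𝔭_{c • w} = (c α)` if `𝔭_w = (α)`. [folklore] -/
theorem span_smul_eq_smul_asIdeal (c : K ≃ₐ[ℚ] K) {w : HeightOneSpectrum (𝓞 K)} {α : 𝓞 K} (hα : Ideal.span {α} = w.asIdeal) :
    Ideal.span {c • α} = (c • w).asIdeal := by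
  rw [Literature.NumberTheory.Automorphic.HeightOneSpectrum.smul_asIdeal, ← hα, Ideal.smul_closure, Set.smul_set_singleton]

/-- **`ψ(ϖ_{c•w})^M ≠ ψ(ϖ_w)^M` for `M ≥ 1`.** `K` imaginary quadratic with `d_K < −4` and `h_K = 1`, `c ∈ Aut(K)`, `ψ` of type
`(1,0)` unramified at `w` and at `c • w`, and `c • w ≠ w`. Otherwise, by §1 at `w` (generator `α`) and at `c • w` (generator `cα`),
`e(cα)^L = e(α)^L` for some `L ≥ 1`, so `(cα/α)^L = 1`, `cα = ±α` (§2) and `c • w = w`.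
[cite: NeukirchANT1999, Ch. VII §6 Cor. (6.14)] [cite: BhargavaVarma2016, Lemma 13] -/
theorem valueAtUniformizer_smul_pow_ne_pow (hK : IsImaginaryQuadratic K) (hD : NumberField.discr K < -4)
    (hPID : IsPrincipalIdealRing (𝓞 K)) (c : K ≃ₐ[ℚ] K) {ψ : HeckeCharacter K}
    (hψ : ψ.HasInfinityType (fun _ ↦ 1) (fun _ ↦ 0)) {w : HeightOneSpectrum (𝓞 K)} (hw : ψ.IsUnramifiedAt w)
    (hcw : ψ.IsUnramifiedAt (c • w)) (hsplit : c • w ≠ w) {M : ℕ} (hM : 0 < M) :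
    ψ.valueAtUniformizer (c • w) ^ M ≠ ψ.valueAtUniformizer w ^ M := by
  haveI := hPID
  -- generators `α` of `𝔭_w` and `c α` of `𝔭_{c w}`
  obtain ⟨α, hα'⟩ := (IsPrincipalIdealRing.principal w.asIdeal).principal
  have hα : Ideal.span {α} = w.asIdeal := by rw [hα']
  have hcα : Ideal.span {c • α} = (c • w).asIdeal := span_smul_eq_smul_asIdeal c hα
  have hα0 : α ≠ 0 := ne_zero_of_span_eq hα
  have hαK : (α : K) ≠ 0 := fun h ↦ hα0 (by exact_mod_cast h)
  obtain ⟨w₀, hw₀⟩ := exists_forall_infinitePlace_eq hK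
  obtain ⟨N₁, hN₁, h₁⟩ := exists_pow_valueAtUniformizer_eq_pow_prod_embedding hK hψ hw hα
  obtain ⟨N₂, hN₂, h₂⟩ := exists_pow_valueAtUniformizer_eq_pow_prod_embedding hK hψ hcw hcα
  rw [prod_infinitePlace_eq hK hw₀] at h₁ h₂
  intro hM'
  -- `e(cα)^L = e(α)^L` with `L = M N₁ N₂`
  have hcoe : ((c • α : 𝓞 K) : K) = c (α : K) := rfl
  have hL : w₀.embedding (c (α : K)) ^ (M * N₁ * N₂) = w₀.embedding (α : K) ^ (M * N₁ * N₂) := by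
    rw [← hcoe]
    calc w₀.embedding ((c • α : 𝓞 K) : K) ^ (M * N₁ * N₂)
        = (w₀.embedding ((c • α : 𝓞 K) : K) ^ N₂) ^ (M * N₁) := by rw [← pow_mul]; ring_nf
      _ = (ψ.valueAtUniformizer (c • w) ^ N₂) ^ (M * N₁) := by rw [h₂]
      _ = (ψ.valueAtUniformizer (c • w) ^ M) ^ (N₁ * N₂) := by rw [← pow_mul, ← pow_mul]; ring_nf
      _ = (ψ.valueAtUniformizer w ^ M) ^ (N₁ * N₂) := by rw [hM']
      _ = (ψ.valueAtUniformizer w ^ N₁) ^ (M * N₂) := by rw [← pow_mul, ← pow_mul]; ring_nf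
      _ = (w₀.embedding (α : K) ^ N₁) ^ (M * N₂) := by rw [h₁]
      _ = w₀.embedding (α : K) ^ (M * N₁ * N₂) := by rw [← pow_mul]; ring_nf
  -- hence `(cα/α)^L = 1` in `K`, so `cα = ±α`
  have hLpos : 0 < M * N₁ * N₂ := Nat.mul_pos (Nat.mul_pos hM hN₁) hN₂
  have hx : (c (α : K) / (α : K)) ^ (M * N₁ * N₂) = 1 := by
    apply w₀.embedding.injective
    rw [map_pow, map_div₀, div_pow, hL, map_one, div_self]
    exact pow_ne_zero _ ((map_ne_zero w₀.embedding).mpr hαK)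
  have hpm : c (α : K) = (α : K) ∨ c (α : K) = -(α : K) := by
    rcases eq_one_or_eq_neg_one_of_pow_eq_one hK.1 hD hLpos hx with h | h
    · left; rwa [div_eq_one_iff_eq hαK] at h
    · right; rw [div_eq_iff hαK] at h; rw [h, neg_one_mul]
  -- so `(cα) = (α)` and `c • w = w`
  have hspan : Ideal.span {c • α} = Ideal.span {α} := by
    rcases hpm with h | h
    · have : c • α = α := NumberField.RingOfIntegers.coe_injective (by
        change ((c • α : 𝓞 K) : K) = (α : K)
        rw [hcoe, h])
      rw [this]
    · have : c • α = -α := NumberField.RingOfIntegers.coe_injective (by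
        change ((c • α : 𝓞 K) : K) = ((-α : 𝓞 K) : K)
        rw [hcoe, h]
        push_cast
        rfl)
      rw [this, Ideal.span_singleton_neg]
  exact hsplit (HeightOneSpectrum.ext (by rw [← hcα, hspan, hα]))

end Summit.BirchSwinnertonDyer.BirchSwinnertonDyer.Theorems.PrintCf2.GoodTwistDictTypePin

end
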